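import Literature.AlgebraicGeometry.Frobenioids.PadicKummerSettingProofs
import Literature.AnabelianGeometry.EtaleTheta.BiKummerThm44SubNHSatFaithful
import HarnessLib

/-!
# [EtTh] Thm 4.4 / [FrdII] §2 AT THE HULL: the Def 2.2 context ISOMORPHISM induced by `Ψ`, and the [FrdII] Def 2.2 (i) /
# Thm 2.4 (i) instance forms at the contexts `def22Ctx` (proof-only)

S. Mochizuki, *The étale theta function …* [MochizukiEtTh2009], Thm 4.4 (iii) p.95; *The geometry of Frobenioids II*
[MochizukiFrdII2008], Def 2.2 (i) p.17 («`G_A ↪ Aut_E(A_E)` … is an isomorphism if, for instance, `A_D` is Galois [where we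
recall that `C` is Aut-ample]»), Thm 2.4 (i) pp.19–20 («compatible … with the various natural actions of `(G_i)_{A_i}/(H_i)_{A_i}`»).

abc-iut-w6-d047 (gen 3), sequel of `BiKummerThm44SubNHSatFaithful` (p461844) whose proof BUILDS, for a Frobenius-trivial Galois
`A″` and `B″ ≅ Ψ(A″)`, an isomorphism of [FrdII] Def 2.2 contexts `def22Ctx A″ ⥲ (def22Ctx B″).conjOuter c` but only uses it
internally.  Here it is EXPOSED (`Thm44Hyp.exists_def22CtxIso_mkOfConnectedTemperoid`), so that abc-iut-L1-d4's whole `Def22Context.Iso`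
API applies BY NAME at the [EtTh] hull — giving NEW INSTANCE FORMS of three frozen [FrdII] §2 fact schemas at the family of contexts
`def22Ctx` (plan/FACT-LIST: F-1196 `GaloisSurjective`, F-1194 `Thm24iActionCompat`, F-1200 `Thm24i` — «universal closure refuted;
instance forms open or model-witnessed»):
* `TemperedFrobenioid.galoisSurjective_def22Ctx_of_isFrobeniusTrivial` — **F-1196 at the hull**: `G_A ⥲ Aut_E(A_E)` for every
  Frobenius-trivial `A` (Galois case), by `Aut`-ampleness of principal objects (`resE_surjective_of_mapAut_surjective`);
  transported to `B″ ≅ Ψ(A″)` by `Iso.galoisSurjective_iff` (`galoisSurjective_def22Ctx_of_iso_Ψ`);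
* `Thm44Hyp.thm24iActionCompat_def22Ctx` — **F-1194 at the hull**: the action-compatibility clause of Thm 2.4 (i) for the comparison
  data `e.thm24Data N` of the exposed context isomorphism (abc-iut-L1-d4's `Iso.thm24iActionCompat`);
* `Thm44Hyp.thm24i_def22Ctx_of_inputs` — **F-1200 at the hull** modulo the three printed inputs of abc-iut-L1-d4's `Iso.thm24i_of_inputs`
  (`p₁ = p₂`, «fieldwise saturated iff», naturality of the chosen local-duality isomorphisms).
PROOF-ONLY (0 definitions).  Binders as in p461844: `hΔ` ([AbsAnab] Lem 1.3.8 ∀-form), `haug_i`, the descended actions `act_i`/`hact_i`.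
HONEST FRAMING: refereed pre-IUT material; typed ≠ proved for the binders; nothing here bears on [IUTchIII] Cor 3.12.
-/

noncomputable section

namespace Literature.AnabelianGeometry.EtaleTheta

open CategoryTheory Opposite Literature.AlgebraicGeometry.Frobenioids Literature.AlgebraicGeometry.Frobenioids.QuasiTemperoid
  Literature.AnabelianGeometry.SemiGraphs Literature.AnabelianGeometry.SemiGraphs.GaloisObjects
  Literature.AnabelianGeometry.EtaleTheta.CnstPushforward


/-! ### §A. [FrdII] Def 2.2 (i) `GaloisSurjective` (F-1196) at `def22Ctx` for Frobenius-trivial objects -/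

namespace TemperedFrobenioid

variable {K : Type} [Field K] (X : TemperedArithmeticGroup.{0} K) {D₀ : Type} [Category.{0} D₀]
  {V : FrdIMonoidStub.{0}} {T₀ : RealifiedDivisorMonoids (D₀ := D₀) V}
  {VD : FrdICatStub.{1, 0, 0} (ConnectedPart (BTemp X.Pi))}
  (tf : TemperedFrobenioid T₀ (ConnectedPart (BTemp X.Pi)) VD) (haug : IsOpenMap X.aug) (A : tf.category)
  (act : MulDistribMulAction (Aut (AE X tf haug A)) ↥(tf.units A))
  (hact : ∀ (α : Aut A) (u : ↥(tf.units A)),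
    (resE X tf haug A α) • u = (⟨α * u.1 * α⁻¹, (tf.units_normal A).conj_mem _ u.2 α⟩ : ↥(tf.units A)))
  (H : Subgroup (Field.absoluteGaloisGroup K)) (hHn : H.Normal) (hHo : IsOpen (H : Set (Field.absoluteGaloisGroup K)))

/-- **[FrdII] Def 2.2 (i) «`G_A ↪ Aut_E(A_E)` is an isomorphism if `A_D` is Galois [`C` Aut-ample]» AT THE HULL CONTEXT `def22Ctx A`
for a FROBENIUS-TRIVIAL `A`** (F-1196 instance form): a Frobenius-trivial object is principal hence `Aut`-ample
(`mapAut_surjective_of_isFrobeniusTrivial`), so `res : Aut_C(A) ↠ Aut_E(A_E)` is surjective at Galois `A`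
(`resE_surjective_of_mapAut_surjective`) and `G_A = Aut_C(A)/Ker(res) → Aut_E(A_E)` is onto. [cite: MochizukiFrdII2008, Def 2.2 (i) p.17] -/
theorem galoisSurjective_def22Ctx_of_isFrobeniusTrivial (hA : PreFrobenioid.IsFrobeniusTrivial tf.toElem A) :
    (def22Ctx X tf haug A act hact H hHn hHo).GaloisSurjective := by
  intro hG τ
  obtain ⟨α, hα⟩ := resE_surjective_of_mapAut_surjective X tf haug A hG (tf.mapAut_surjective_of_isFrobeniusTrivial A hA) τ
  exact ⟨QuotientGroup.mk α, by rw [PadicKummer.Def22Context.gaToAutE, QuotientGroup.kerLift_mk]; exact hα⟩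

end TemperedFrobenioid

/-! ### §B. The context isomorphism induced by `Ψ` (exposed), and the Thm 2.4 (i) instance forms -/

namespace BiKummerSetting


/-- `σ ↦ e⁻¹ ∘ Ψ(σ) ∘ e` is a group homomorphism `Aut(A) → Aut(B)`: it carries `α u α⁻¹` to the conjugate of the images
(bookkeeping for the Ψ-equivariance of the descended actions; stated over bare categories so that it applies by `exact`
across the definitional identifications `S.C = tf.category`). [cite: MochizukiEtTh2009, Thm 4.4 p.94] -/
private theorem conjAut_mapAut_conj {C₁ : Type*} [Category C₁] {C₂ : Type*} [Category C₂] (F : C₁ ⥤ C₂) {A : C₁}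
    {B : C₂} (e : F.obj A ≅ B) (α u : Aut A) :
    e.conjAut (F.mapAut A (α * u * α⁻¹)) =
      e.conjAut (F.mapAut A α) * e.conjAut (F.mapAut A u) * (e.conjAut (F.mapAut A α))⁻¹ := by
  simp only [map_mul, map_inv]

variable {K : Type} [Field K] {K' : Type} [Field K'] {X₁ : SemiGraphs.TemperedArithmeticGroup.{0} K}
  {X₂ : SemiGraphs.TemperedArithmeticGroup.{0} K'} {D₀ : Type} [Category.{0} D₀] {D₀' : Type}
  [Category.{0} D₀'] {V : FrdIMonoidStub.{0}} {T₁ : RealifiedDivisorMonoids (D₀ := D₀) V}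
  {T₂ : RealifiedDivisorMonoids (D₀ := D₀') V}
  {VD₁ : FrdICatStub.{1, 0, 0} (ConnectedPart (BTemp X₁.Pi))}
  {VD₂ : FrdICatStub.{1, 0, 0} (ConnectedPart (BTemp X₂.Pi))}
  {tf₁ : TemperedFrobenioid T₁ (ConnectedPart (BTemp X₁.Pi)) VD₁} {hZ₁ : tf₁.monoidType = MonoidType.Z}
  {hP₁ : ∀ A : (ConnectedPart (BTemp X₁.Pi))ᵒᵖ, IsPerfect (tf₁.Φ.carrier A)}
  {NH₁ : Subgroup (Field.absoluteGaloisGroup K) → tf₁.category → ℕ+ → Prop} {A₁ : tf₁.category}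
  {hA₁ : PreFrobenioid.IsFrobeniusTrivial tf₁.toElem A₁} {hA₁' : SemiGraphs.IsGaloisObj A₁.base.obj}
  {tf₂ : TemperedFrobenioid T₂ (ConnectedPart (BTemp X₂.Pi)) VD₂} {hZ₂ : tf₂.monoidType = MonoidType.Z}
  {hP₂ : ∀ B : (ConnectedPart (BTemp X₂.Pi))ᵒᵖ, IsPerfect (tf₂.Φ.carrier B)}
  {NH₂ : Subgroup (Field.absoluteGaloisGroup K') → tf₂.category → ℕ+ → Prop} {A₂ : tf₂.category}
  {hA₂ : PreFrobenioid.IsFrobeniusTrivial tf₂.toElem A₂} {hA₂' : SemiGraphs.IsGaloisObj A₂.base.obj}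

/-- **The [FrdII] Def 2.2 context ISOMORPHISM induced by `Ψ`, EXPOSED**: for `h : Thm44Hyp` at the genuine connected bases, a
Frobenius-trivial Galois `A″ ∈ Ob(C₁)` and any `e : Ψ(A″) ≅ B″`, `B″^bs` is Galois and there are `c ∈ G_{K₂}` and an isomorphism of
contexts `def22Ctx A″ ⥲ (def22Ctx B″).conjOuter c` (at `H_i := H^{bs-fld}_{⊙,i}`) — the object the proof of
`preservesNHSaturatedBsFld_mkOfConnectedTemperoid_faithful` (p461844) builds internally: `isoC := e⁻¹ Ψ(−) e`, `isoO` (units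
transport), `isoE`/`isoG`/`c` (push-forward square + outer representatives), all laws PROVED (Ψ-equivariance via `Aut`-ampleness
of the principal object `A″`). [cite: MochizukiEtTh2009, Thm 4.4 (iii) p.95] -/
theorem Thm44Hyp.exists_def22CtxIso_mkOfConnectedTemperoid
    (h : Thm44Hyp (mkOfConnectedTemperoid X₁ tf₁ hZ₁ hP₁ NH₁ A₁ hA₁ hA₁')
      (mkOfConnectedTemperoid X₂ tf₂ hZ₂ hP₂ NH₂ A₂ hA₂ hA₂'))
    (hΔ : ∀ θ : X₁.Pi ≃ₜ* X₂.Pi, X₁.delta.map θ.toMulEquiv.toMonoidHom = X₂.delta)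
    (haug₁ : IsOpenMap X₁.aug) (haug₂ : IsOpenMap X₂.aug)
    (act₁ : ∀ A : tf₁.category, MulDistribMulAction (Aut (TemperedFrobenioid.AE X₁ tf₁ haug₁ A)) ↥(tf₁.units A))
    (hact₁ : ∀ (A : tf₁.category) (α : Aut A) (u : ↥(tf₁.units A)),
      (TemperedFrobenioid.resE X₁ tf₁ haug₁ A α) • u =
        (⟨α * u.1 * α⁻¹, (tf₁.units_normal A).conj_mem _ u.2 α⟩ : ↥(tf₁.units A)))
    (act₂ : ∀ B : tf₂.category, MulDistribMulAction (Aut (TemperedFrobenioid.AE X₂ tf₂ haug₂ B)) ↥(tf₂.units B))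
    (hact₂ : ∀ (B : tf₂.category) (α : Aut B) (u : ↥(tf₂.units B)),
      (TemperedFrobenioid.resE X₂ tf₂ haug₂ B α) • u =
        (⟨α * u.1 * α⁻¹, (tf₂.units_normal B).conj_mem _ u.2 α⟩ : ↥(tf₂.units B)))
    (A'' : tf₁.category) (hft : PreFrobenioid.IsFrobeniusTrivial tf₁.toElem A'') (hA : SemiGraphs.IsGaloisObj A''.base.obj)
    (B'' : tf₂.category) (e : h.Ψ.functor.obj A'' ≅ B'') :
    SemiGraphs.IsGaloisObj B''.base.obj ∧ ∃ c : Field.absoluteGaloisGroup K',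
      Nonempty (PadicKummer.Def22Context.Iso
        (TemperedFrobenioid.def22Ctx X₁ tf₁ haug₁ A'' (act₁ A'') (hact₁ A'') (mkOfConnectedTemperoid X₁ tf₁ hZ₁ hP₁ NH₁ A₁ hA₁ hA₁').HodotBsFld
        (mkOfConnectedTemperoid X₁ tf₁ hZ₁ hP₁ NH₁ A₁ hA₁ hA₁').hodotBsFld_normal ((mkOfConnectedTemperoid X₁ tf₁ hZ₁ hP₁ NH₁ A₁ hA₁ hA₁').isOpen_hodotBsFld_of_isOpenMap h.isOpen_Hodot₁ haug₁))
        ((TemperedFrobenioid.def22Ctx X₂ tf₂ haug₂ B'' (act₂ B'') (hact₂ B'') (mkOfConnectedTemperoid X₂ tf₂ hZ₂ hP₂ NH₂ A₂ hA₂ hA₂').HodotBsFld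
        (mkOfConnectedTemperoid X₂ tf₂ hZ₂ hP₂ NH₂ A₂ hA₂ hA₂').hodotBsFld_normal ((mkOfConnectedTemperoid X₂ tf₂ hZ₂ hP₂ NH₂ A₂ hA₂ hA₂').isOpen_hodotBsFld_of_isOpenMap h.isOpen_Hodot₂ haug₂)).conjOuter c)) := by
    obtain ⟨hB, ι, E, c, hιH, hc, hres⟩ := h.exists_def22OuterData_res_mkOfConnectedTemperoid hΔ haug₁ haug₂ A'' hA
      B'' e (TemperedFrobenioid.outerRep_aug X₁ tf₁ haug₁ A'' hA)
      (fun hB g => TemperedFrobenioid.outerRep_aug X₂ tf₂ haug₂ B'' hB g)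
    obtain ⟨isoO, hisoO⟩ := h.exists_unitsEquiv e
    -- `A″` Frobenius-trivial (= principal) ⇒ `Aut`-ample ⇒ `res₁ : Aut_{C₁}(A″) ↠ Aut_{E₁}(A″_E)` SURJECTIVE (A″ Galois)
    have hsurj : Function.Surjective (TemperedFrobenioid.resE X₁ tf₁ haug₁ A'') :=
      TemperedFrobenioid.resE_surjective_of_mapAut_surjective X₁ tf₁ haug₁ A'' hA
        (tf₁.mapAut_surjective_of_isFrobeniusTrivial A'' hft)
    have hres' : ∀ α : Aut A'', E (TemperedFrobenioid.resE X₁ tf₁ haug₁ A'' α) =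
        TemperedFrobenioid.resE X₂ tf₂ haug₂ B'' (e.conjAut (h.Ψ.functor.mapAut A'' α)) := hres
    -- Ψ-EQUIVARIANCE of the descended `Aut_E`-actions (the former binder `hΨact`), from `hact₁`/`hact₂` through the square
    have key : ∀ (τ : Aut (TemperedFrobenioid.AE X₁ tf₁ haug₁ A'')) (u : ↥(tf₁.units A'')) (v : ↥(tf₂.units B'')),
        v.1 = e.conjAut (h.Ψ.functor.mapAut A'' u.1) →
        letI := act₁ A''; letI := act₂ B''
        (E τ • v).1 = e.conjAut (h.Ψ.functor.mapAut A'' (τ • u).1) := by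
      intro τ u v hv
      letI := act₁ A''; letI := act₂ B''
      obtain ⟨α, rfl⟩ := hsurj τ
      rw [hres' α, hact₂ B'' _ v, hact₁ A'' α u]
      simp only [hv]
      exact (conjAut_mapAut_conj h.Ψ.functor e α u.1).symm
    exact ⟨hB, c, ⟨
      { isoC := (h.Ψ.fullyFaithfulFunctor.autMulEquivOfFullyFaithful A'').trans (Iso.conjAut e)
        isoO := isoO
        isoE := E
        isoG := ι
        res_isoC := fun α => (hres α).symm
        isoO_smul := fun τ u => by
          apply Subtype.ext
          have := key τ u (isoO u) (hisoO u)
          exact (hisoO _).trans this.symm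
        outer_isoG := fun g => by
          change (MulAut.conj (TemperedFrobenioid.outerRep X₂ tf₂ haug₂ B'' c)).toMonoidHom.comp
              (TemperedFrobenioid.outerRep X₂ tf₂ haug₂ B'') (ι g) = E (TemperedFrobenioid.outerRep X₁ tf₁ haug₁ A'' g)
          rw [hc, MonoidHom.comp_apply, MulEquiv.coe_toMonoidHom, MulAut.conj_apply]
        map_H := hιH
        isGalois_iff := ⟨fun _ => hB, fun _ => hA⟩ }⟩⟩

/-- **[FrdII] Thm 2.4 (i), final clause «compatible … with the various natural actions of `(G_i)_{A_i}/(H_i)_{A_i}`» AT THE HULL**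
(F-1194 instance form): for the comparison data `e.thm24Data N` of the exposed context isomorphism, abc-iut-L1-d4's PROVED
`Def22Context.Iso.thm24iActionCompat` applies BY NAME, every `N`. [cite: MochizukiFrdII2008, Thm 2.4 (i) p.20] -/
theorem Thm44Hyp.thm24iActionCompat_def22Ctx
    (h : Thm44Hyp (mkOfConnectedTemperoid X₁ tf₁ hZ₁ hP₁ NH₁ A₁ hA₁ hA₁')
      (mkOfConnectedTemperoid X₂ tf₂ hZ₂ hP₂ NH₂ A₂ hA₂ hA₂'))
    (hΔ : ∀ θ : X₁.Pi ≃ₜ* X₂.Pi, X₁.delta.map θ.toMulEquiv.toMonoidHom = X₂.delta)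
    (haug₁ : IsOpenMap X₁.aug) (haug₂ : IsOpenMap X₂.aug)
    (act₁ : ∀ A : tf₁.category, MulDistribMulAction (Aut (TemperedFrobenioid.AE X₁ tf₁ haug₁ A)) ↥(tf₁.units A))
    (hact₁ : ∀ (A : tf₁.category) (α : Aut A) (u : ↥(tf₁.units A)),
      (TemperedFrobenioid.resE X₁ tf₁ haug₁ A α) • u =
        (⟨α * u.1 * α⁻¹, (tf₁.units_normal A).conj_mem _ u.2 α⟩ : ↥(tf₁.units A)))
    (act₂ : ∀ B : tf₂.category, MulDistribMulAction (Aut (TemperedFrobenioid.AE X₂ tf₂ haug₂ B)) ↥(tf₂.units B))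
    (hact₂ : ∀ (B : tf₂.category) (α : Aut B) (u : ↥(tf₂.units B)),
      (TemperedFrobenioid.resE X₂ tf₂ haug₂ B α) • u =
        (⟨α * u.1 * α⁻¹, (tf₂.units_normal B).conj_mem _ u.2 α⟩ : ↥(tf₂.units B)))
    (A'' : tf₁.category) (hft : PreFrobenioid.IsFrobeniusTrivial tf₁.toElem A'') (hA : SemiGraphs.IsGaloisObj A''.base.obj)
    (B'' : tf₂.category) (e : h.Ψ.functor.obj A'' ≅ B'') :
    ∃ (c : Field.absoluteGaloisGroup K') (ε : PadicKummer.Def22Context.Iso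
        (TemperedFrobenioid.def22Ctx X₁ tf₁ haug₁ A'' (act₁ A'') (hact₁ A'') (mkOfConnectedTemperoid X₁ tf₁ hZ₁ hP₁ NH₁ A₁ hA₁ hA₁').HodotBsFld
        (mkOfConnectedTemperoid X₁ tf₁ hZ₁ hP₁ NH₁ A₁ hA₁ hA₁').hodotBsFld_normal ((mkOfConnectedTemperoid X₁ tf₁ hZ₁ hP₁ NH₁ A₁ hA₁ hA₁').isOpen_hodotBsFld_of_isOpenMap h.isOpen_Hodot₁ haug₁))
        ((TemperedFrobenioid.def22Ctx X₂ tf₂ haug₂ B'' (act₂ B'') (hact₂ B'') (mkOfConnectedTemperoid X₂ tf₂ hZ₂ hP₂ NH₂ A₂ hA₂ hA₂').HodotBsFld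
        (mkOfConnectedTemperoid X₂ tf₂ hZ₂ hP₂ NH₂ A₂ hA₂ hA₂').hodotBsFld_normal ((mkOfConnectedTemperoid X₂ tf₂ hZ₂ hP₂ NH₂ A₂ hA₂ hA₂').isOpen_hodotBsFld_of_isOpenMap h.isOpen_Hodot₂ haug₂)).conjOuter c)),
      ∀ N : ℕ, PadicKummer.Thm24iActionCompat _ _ N (ε.thm24Data N) := by
  obtain ⟨-, c, ⟨ε⟩⟩ := h.exists_def22CtxIso_mkOfConnectedTemperoid hΔ haug₁ haug₂ act₁ hact₁ act₂ hact₂ A'' hft hA B'' e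
  exact ⟨c, ε, fun N => ε.thm24iActionCompat N⟩

/-- **[FrdII] Thm 2.4 (i) AT THE HULL modulo its three printed inputs** (F-1200 instance form): for the comparison data
`e.thm24Data N` of the exposed context isomorphism, `Thm24i` holds given `p₁ = p₂` ([AbsAnab] Prop 1.2.1 (i)), «`Φ₁` fieldwise
saturated iff `Φ₂`» ([FrdI] Cor 4.10/4.11) and the naturality of the chosen local-duality isomorphisms ([NSW] 7.2.6) —
abc-iut-L1-d4's `Def22Context.Iso.thm24i_of_inputs` BY NAME; saturation transfer, the five isomorphisms and the Kummer
compatibility are PROVED there. [cite: MochizukiFrdII2008, Thm 2.4 (i) p.19] -/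
theorem Thm44Hyp.thm24i_def22Ctx_of_inputs
    (h : Thm44Hyp (mkOfConnectedTemperoid X₁ tf₁ hZ₁ hP₁ NH₁ A₁ hA₁ hA₁')
      (mkOfConnectedTemperoid X₂ tf₂ hZ₂ hP₂ NH₂ A₂ hA₂ hA₂'))
    (hΔ : ∀ θ : X₁.Pi ≃ₜ* X₂.Pi, X₁.delta.map θ.toMulEquiv.toMonoidHom = X₂.delta)
    (haug₁ : IsOpenMap X₁.aug) (haug₂ : IsOpenMap X₂.aug)
    (act₁ : ∀ A : tf₁.category, MulDistribMulAction (Aut (TemperedFrobenioid.AE X₁ tf₁ haug₁ A)) ↥(tf₁.units A))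
    (hact₁ : ∀ (A : tf₁.category) (α : Aut A) (u : ↥(tf₁.units A)),
      (TemperedFrobenioid.resE X₁ tf₁ haug₁ A α) • u =
        (⟨α * u.1 * α⁻¹, (tf₁.units_normal A).conj_mem _ u.2 α⟩ : ↥(tf₁.units A)))
    (act₂ : ∀ B : tf₂.category, MulDistribMulAction (Aut (TemperedFrobenioid.AE X₂ tf₂ haug₂ B)) ↥(tf₂.units B))
    (hact₂ : ∀ (B : tf₂.category) (α : Aut B) (u : ↥(tf₂.units B)),
      (TemperedFrobenioid.resE X₂ tf₂ haug₂ B α) • u =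
        (⟨α * u.1 * α⁻¹, (tf₂.units_normal B).conj_mem _ u.2 α⟩ : ↥(tf₂.units B)))
    (A'' : tf₁.category) (hft : PreFrobenioid.IsFrobeniusTrivial tf₁.toElem A'') (hA : SemiGraphs.IsGaloisObj A''.base.obj)
    (B'' : tf₂.category) (e : h.Ψ.functor.obj A'' ≅ B'') :
    ∃ (c : Field.absoluteGaloisGroup K') (ε : PadicKummer.Def22Context.Iso
        (TemperedFrobenioid.def22Ctx X₁ tf₁ haug₁ A'' (act₁ A'') (hact₁ A'') (mkOfConnectedTemperoid X₁ tf₁ hZ₁ hP₁ NH₁ A₁ hA₁ hA₁').HodotBsFld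
        (mkOfConnectedTemperoid X₁ tf₁ hZ₁ hP₁ NH₁ A₁ hA₁ hA₁').hodotBsFld_normal ((mkOfConnectedTemperoid X₁ tf₁ hZ₁ hP₁ NH₁ A₁ hA₁ hA₁').isOpen_hodotBsFld_of_isOpenMap h.isOpen_Hodot₁ haug₁))
        ((TemperedFrobenioid.def22Ctx X₂ tf₂ haug₂ B'' (act₂ B'') (hact₂ B'') (mkOfConnectedTemperoid X₂ tf₂ hZ₂ hP₂ NH₂ A₂ hA₂ hA₂').HodotBsFld
        (mkOfConnectedTemperoid X₂ tf₂ hZ₂ hP₂ NH₂ A₂ hA₂ hA₂').hodotBsFld_normal ((mkOfConnectedTemperoid X₂ tf₂ hZ₂ hP₂ NH₂ A₂ hA₂ hA₂').isOpen_hodotBsFld_of_isOpenMap h.isOpen_Hodot₂ haug₂)).conjOuter c)),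
      ∀ (N p₁ p₂ : ℕ) (fs₁ fs₂ : Prop) (ι₁ : Kummer.DualityIso N _ _ (TemperedFrobenioid.def22Ctx X₁ tf₁ haug₁ A'' (act₁ A'') (hact₁ A'') (mkOfConnectedTemperoid X₁ tf₁ hZ₁ hP₁ NH₁ A₁ hA₁ hA₁').HodotBsFld
        (mkOfConnectedTemperoid X₁ tf₁ hZ₁ hP₁ NH₁ A₁ hA₁ hA₁').hodotBsFld_normal ((mkOfConnectedTemperoid X₁ tf₁ hZ₁ hP₁ NH₁ A₁ hA₁ hA₁').isOpen_hodotBsFld_of_isOpenMap h.isOpen_Hodot₁ haug₁)).qHA)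
        (ι₂ : Kummer.DualityIso N _ _ ((TemperedFrobenioid.def22Ctx X₂ tf₂ haug₂ B'' (act₂ B'') (hact₂ B'') (mkOfConnectedTemperoid X₂ tf₂ hZ₂ hP₂ NH₂ A₂ hA₂ hA₂').HodotBsFld
        (mkOfConnectedTemperoid X₂ tf₂ hZ₂ hP₂ NH₂ A₂ hA₂ hA₂').hodotBsFld_normal ((mkOfConnectedTemperoid X₂ tf₂ hZ₂ hP₂ NH₂ A₂ hA₂ hA₂').isOpen_hodotBsFld_of_isOpenMap h.isOpen_Hodot₂ haug₂)).conjOuter c).qHA),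
        p₁ = p₂ → (fs₁ ↔ fs₂) →
        (∀ x, (ε.thm24Data N).recTargetMap (ι₁.toAddEquiv x) = ι₂.toAddEquiv (ε.isoH1 N x)) →
          PadicKummer.Thm24i _ _ N p₁ p₂ fs₁ fs₂ (ε.thm24Data N) ι₁ ι₂ := by
  obtain ⟨-, c, ⟨ε⟩⟩ := h.exists_def22CtxIso_mkOfConnectedTemperoid hΔ haug₁ haug₂ act₁ hact₁ act₂ hact₂ A'' hft hA B'' e
  exact ⟨c, ε, fun N p₁ p₂ fs₁ fs₂ ι₁ ι₂ hp hfs hι => ε.thm24i_of_inputs N p₁ p₂ fs₁ fs₂ ι₁ ι₂ hp hfs hι⟩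

/-- **F-1196 transported along `Ψ`**: for `B″ ≅ Ψ(A″)` with `A″` Frobenius-trivial Galois, `G_{B″} ⥲ Aut_E(B″_E)` as well — by
abc-iut-L1-d4's `Iso.galoisSurjective_iff` along the exposed context isomorphism (no Frobenius-triviality of `B″` assumed; the
`conjOuter` twist does not touch `G_A`/`res`). [cite: MochizukiFrdII2008, Def 2.2 (i) p.17] -/
theorem Thm44Hyp.galoisSurjective_def22Ctx_of_iso_Ψ
    (h : Thm44Hyp (mkOfConnectedTemperoid X₁ tf₁ hZ₁ hP₁ NH₁ A₁ hA₁ hA₁')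
      (mkOfConnectedTemperoid X₂ tf₂ hZ₂ hP₂ NH₂ A₂ hA₂ hA₂'))
    (hΔ : ∀ θ : X₁.Pi ≃ₜ* X₂.Pi, X₁.delta.map θ.toMulEquiv.toMonoidHom = X₂.delta)
    (haug₁ : IsOpenMap X₁.aug) (haug₂ : IsOpenMap X₂.aug)
    (act₁ : ∀ A : tf₁.category, MulDistribMulAction (Aut (TemperedFrobenioid.AE X₁ tf₁ haug₁ A)) ↥(tf₁.units A))
    (hact₁ : ∀ (A : tf₁.category) (α : Aut A) (u : ↥(tf₁.units A)),
      (TemperedFrobenioid.resE X₁ tf₁ haug₁ A α) • u =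
        (⟨α * u.1 * α⁻¹, (tf₁.units_normal A).conj_mem _ u.2 α⟩ : ↥(tf₁.units A)))
    (act₂ : ∀ B : tf₂.category, MulDistribMulAction (Aut (TemperedFrobenioid.AE X₂ tf₂ haug₂ B)) ↥(tf₂.units B))
    (hact₂ : ∀ (B : tf₂.category) (α : Aut B) (u : ↥(tf₂.units B)),
      (TemperedFrobenioid.resE X₂ tf₂ haug₂ B α) • u =
        (⟨α * u.1 * α⁻¹, (tf₂.units_normal B).conj_mem _ u.2 α⟩ : ↥(tf₂.units B)))
    (A'' : tf₁.category) (hft : PreFrobenioid.IsFrobeniusTrivial tf₁.toElem A'') (hA : SemiGraphs.IsGaloisObj A''.base.obj)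
    (B'' : tf₂.category) (e : h.Ψ.functor.obj A'' ≅ B'') :
    (TemperedFrobenioid.def22Ctx X₂ tf₂ haug₂ B'' (act₂ B'') (hact₂ B'') (mkOfConnectedTemperoid X₂ tf₂ hZ₂ hP₂ NH₂ A₂ hA₂ hA₂').HodotBsFld
        (mkOfConnectedTemperoid X₂ tf₂ hZ₂ hP₂ NH₂ A₂ hA₂ hA₂').hodotBsFld_normal ((mkOfConnectedTemperoid X₂ tf₂ hZ₂ hP₂ NH₂ A₂ hA₂ hA₂').isOpen_hodotBsFld_of_isOpenMap h.isOpen_Hodot₂ haug₂)).GaloisSurjective := by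
  obtain ⟨-, c, ⟨ε⟩⟩ := h.exists_def22CtxIso_mkOfConnectedTemperoid hΔ haug₁ haug₂ act₁ hact₁ act₂ hact₂ A'' hft hA B'' e
  exact ε.galoisSurjective_iff.mp
    (TemperedFrobenioid.galoisSurjective_def22Ctx_of_isFrobeniusTrivial X₁ tf₁ haug₁ A'' (act₁ A'') (hact₁ A'') _ _ _ hft)

end BiKummerSetting

end Literature.AnabelianGeometry.EtaleTheta

end
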